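import Mathlib.Geometry.Manifold.Instances.Real
import Mathlib.Analysis.InnerProductSpace.PiL2
import Literature.Geometry.Lorentzian.Development
import Literature.Geometry.Lorentzian.Causality
import Literature.Geometry.Lorentzian.Geodesic
import Literature.Geometry.Lorentzian.TrappedSurface
import Literature.Geometry.Lorentzian.Einstein
import Literature.Geometry.Lorentzian.KerrSchild
import Literature.Geometry.Lorentzian.ModelData
import HarnessLib

-- provenance: harness21/H21/H21/Statements/GR/CauchyProblem.lean @ 0bdcb27 (interim HEAD d8f2665); M5 mechanical rewrite
-- D-0014 sorry-free migration + `HasLeviCivita`/universe elaboration fix (prover-migrate-pool-A-g21-0, 2026-08-13)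
-- verdict clean-up (defact-verdict seat, 2026-08-15): the two gr.S12 existence facts over `VacuumDevelopment` are
-- deprecated (false as stated, refuted in `CauchyProblemExistenceDefect`); statements unchanged
/-!
# The Cauchy problem in general relativity: MGHD and the Penrose singularity theorem
(family `gr`, statements **gr.S12**, **gr.S11**; trunk G08 = T-LORENTZ, outline
`H21/Outlines/Lorentz.md` §3 ST1, item `GRCauchyProblem`; namespace `Literature.GR`)

This statement file records, on top of the Lorentz prelude (`Development`, `Causality`,
`Geodesic`, `TrappedSurface`, `Einstein`, `KerrSchild`, `ModelData`):

* **gr.S12** — the Choquet-Bruhat–Geroch theorem: every smooth vacuum initial data set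
  `(Σ, h, k)` solving the vacuum constraint equations has a maximal globally hyperbolic vacuum
  development (MGHD), unique up to an isometry fixing `Σ`, together with the local existence
  theorem of Fourès-Bruhat (1952). Of the three M5 renderings only the uniqueness clause
  `mghd_unique` stays in force (it holds, vacuously, `mghd_unique_holds`, `CauchyProblemProofs`);
  the two existence renderings `choquetBruhat_geroch_exists_mghd`,
  `choquetBruhat_local_existence`, stated over the uninhabited structure `VacuumDevelopment`,
  are **false as stated, refuted in the tree, and deprecated** (§ Verdict clean-up below, where
  the corrected statements over `VacuumCauchyDevelopment` are recorded).
  Choquet-Bruhat–Geroch, Comm. Math. Phys. 14 (1969), 329–335, Thm. 1 (p. 331) and Thm. 3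
  (p. 332); Fourès-Bruhat, Acta Math. 88 (1952), 141–225; Sbierski, Ann. Henri Poincaré 17
  (2016), 301–329 = arXiv:1309.7591v3, Thm. 2.6 and Thm. 2.8 (de-Zornification); Ringström,
  *The Cauchy Problem in General Relativity* (EMS 2009), Thm. 14.2 and Thm. 16.6.
* **gr.S11** — the Penrose singularity theorem: a globally hyperbolic spacetime with a
  non-compact Cauchy hypersurface, satisfying the null convergence condition
  `Ric(v, v) ≥ 0` for null `v`, and containing a closed trapped surface, is future null
  geodesically incomplete (`penrose_singularity_theorem`). Penrose, Phys. Rev. Lett. 14 (1965),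
  57–59; Hawking–Ellis, *The large scale structure of space-time* (1973), §8.2, Thm. 1;
  O'Neill, *Semi-Riemannian Geometry* (1983), Thm. 14.61.
* untagged sanity statements: Minkowski spacetime is geodesically complete
  (`minkowski_isGeodesicallyComplete`) and globally hyperbolic
  (`minkowski_isGloballyHyperbolic`).

## Mathlib

Mathlib (at the pin) has the real model `𝓡 n`, `IsManifold`, `EuclideanSpace`, but no
Lorentzian geometry, Cauchy problem, developments, trapped surfaces or geodesic completeness
(`rg -i 'globally hyperbolic|cauchy development|trapped|geodesically complete'
Mathlib/Geometry` finds nothing). All notions used are the accepted H21 ones: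
`InitialDataSet`, `InitialDataSet.IsVacuumConstraintSolution`, `VacuumDevelopment`,
`VacuumDevelopment.IsMaximal`, `Development.IsIsometricTo`, `Spacetime`,
`LorentzianMetric.IsGloballyHyperbolic`, `LorentzianMetric.IsCauchySurface`,
`LorentzianMetric.SatisfiesNullConvergence`, `LorentzianMetric.IsTrappedSurface`,
`LorentzianMetric.IsFutureNullGeodesicallyIncomplete`, `IsGeodesicallyComplete`,
`PseudoRiemannianMetric.leviCivita`, `Minkowski.spacetime`. This file defines no notion.

## Design choices

* The data manifold is called `X` (`Σ` is a Lean token). The `Σ`-context is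
  `(X : Type) [TopologicalSpace X] [ChartedSpace E3 X] [IsManifold (𝓡 3) ∞ X]
  [ConnectedSpace X]`, with `[T2Space X] [SecondCountableTopology X]` bound *inside* the two
  existence facts (a `def … : Prop` only abstracts the section variables its body uses, and
  without them both existence statements are false, e.g. for the line with two origins: a
  development is Hausdorff and second countable and `X` embeds in it; M5 review)
  (outline §3, review F6): connectedness is
  required since `Spacetime` is connected and a Cauchy surface of a connected spacetime is
  connected, so that the existence statement would be false for disconnected `X`.
  Developments live in universe `0` (`X : Type`), and maximality quantifies over developments in
  that universe (`VacuumDevelopment.IsMaximal`, outline decision (g)).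
* "Smooth vacuum initial data set" = `InitialDataSet (𝓡 3) X` (a `C^∞` Riemannian metric `h`
  and a `C^∞` symmetric `2`-tensor `k`) satisfying `IsVacuumConstraintSolution` (Gauss and
  Codazzi constraints with vanishing source).
* Uniqueness of the MGHD is stated as `Development.IsIsometricTo` (a time-orientation
  preserving isometric diffeomorphism commuting with the embeddings of `X`), exactly the
  uniqueness clause of Choquet-Bruhat–Geroch.
* In the Penrose theorem the trapped surface is a map `f : T → M` from a compact `2`-manifold
  (`IsTrappedSurface (𝓡 2)`: compact, smoothly embedded, spacelike, both null expansions
  negative for every null normal pair — sign convention (h) of the outline, θ± = tr_S k ± H).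
  Global hyperbolicity is the Bernal–Sánchez form and the Cauchy surface is a `Set` of the
  carrier (`IsCauchySurface`); both hypotheses are kept, as in Hawking–Ellis §8.2, Thm. 1
  (O'Neill 14.61 assumes only global hyperbolicity + non-compact Cauchy surface, which is the
  same thing by Geroch's splitting).
* **Standing hypothesis `[g.HasLeviCivita]` (M5 migration note).** The constraint functions
  (`IsVacuumConstraintSolution`), the Ricci tensor (`SatisfiesNullConvergence`), the null
  expansions (`IsTrappedSurface`) and the geodesic notions (`leviCivita`,
  `IsFutureNullGeodesicallyIncomplete`) of the prelude take the instance argument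
  `[g.HasLeviCivita]` (the conclusion of the named fact
  `PseudoRiemannianMetric.isCovariantDerivativeOn_leviCivitaFun`, O'Neill 1983, Ch. 3,
  Thm. 3.11; see `LeviCivita.lean`). The named facts below bind it right after the metric it
  concerns (`[D.metric.HasLeviCivita]`, `[𝓢.metric.HasLeviCivita]`,
  `[Minkowski.spacetime.metric.HasLeviCivita]`), exactly as `Kerr.isRicciFlat` and
  `Kerr.data_isVacuumConstraintSolution` do; a consumer instantiates it with `HasLeviCivita.of`.
* The Penrose theorem quantifies over spacetimes `Spacetime.{u} 4` in an arbitrary universe `u`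
  (the trapped `2`-manifold `T : Type`).

## Verdict clean-up (2026-08-15): the two existence facts of gr.S12 are deprecated

The M5 renderings `choquetBruhat_geroch_exists_mghd` (`… → ∃ 𝒟 : VacuumDevelopment D,
𝒟.IsMaximal`) and `choquetBruhat_local_existence` (`… → Nonempty (VacuumDevelopment D)`) are
**false as stated** and refuted in the tree (`not_choquetBruhat_geroch_exists_mghd`,
`not_choquetBruhat_local_existence`, with the forms `…_iff` — each `def` says "`X` carries no
vacuum data" — and `…_iff_false`, all in `CauchyProblemExistenceDefect`): the prelude structure
`VacuumDevelopment D` (`Development.lean`) is **uninhabited for every data set**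
(`VacuumDevelopment.isEmpty`, `Development.elim`, `DevelopmentProofs`), because its field
`isCauchySurface` is the mis-formalised notion `LorentzianMetric.IsCauchySurface` (`Causality`),
which counts every timelike curve with unbounded parameter set as inextendible and is therefore
uninhabited on nonempty manifolds (`LorentzianMetric.IsCauchySurface.isEmpty`, `CausalityProofs`),
while the hypotheses are met by the trivial data `(ℝ³, δ, 0)` on the Minkowski slice
(`trivialData_isVacuumConstraintSolution_holds`, `ModelDataProofs`). Dually, the `∀ 𝒟`-facts
`mghd_unique` and `penrose_singularity_theorem` hold vacuously (`CauchyProblemProofs`). The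
printed theorems are true.

Following the verdicts of the two fact seats (misstated / refuted), both `def`s are **retired
from use**: they are kept with their statements byte-for-byte, marked `@[deprecated]` (since
2026-08-15) and documented as mis-renderings, solely as the subjects of the refutation theorems of
`CauchyProblemExistenceDefect` (their only users besides the bookkeeping theorem
`nonempty_vacuumCauchyDevelopment_of_choquetBruhat_local_existence` of
`MinkowskiCauchyDevelopment`); the in-file link `choquetBruhat_local_existence_of_exists_mghd` is
deprecated with them. No consumer may take either as a hypothesis (each is `False` at
`X = Minkowski.slice`).

**The corrected statements** are the deprecated ones *verbatim* with
`VacuumDevelopment ↦ VacuumCauchyDevelopment`, the repaired structure of `CauchyDevelopment.lean`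
(Cauchy-surface field = the faithful `LorentzianMetric.IsCauchyHypersurface`, O'Neill 1983,
Def. 14.28, which is Choquet-Bruhat–Geroch's footnote 5, p. 331; inhabited at the trivial data by
Minkowski spacetime, `Minkowski.vacuumCauchyDevelopment`, `MinkowskiCauchyDevelopment`), in the
`Σ`-context of this file:

* MGHD existence (Choquet-Bruhat–Geroch 1969, Thm. 3, p. 332: "Let S be an initial data set.
  Then there exists a development M of S which is an extension of every other development of S.
  This development is unique (up to isometry)"; Sbierski, arXiv:1309.7591v3, Thm. 2.8;
  Ringström 2009, Thm. 16.6), to be named `choquetBruhat_geroch_exists_mghd_cauchy`: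
  `∀ [T2Space X] [SecondCountableTopology X] (D : InitialDataSet (𝓡 3) X) [D.metric.HasLeviCivita],
     D.IsVacuumConstraintSolution → ∃ 𝒟 : VacuumCauchyDevelopment D, 𝒟.IsMaximal`;
* local existence (Fourès-Bruhat 1952; Choquet-Bruhat–Geroch 1969, Thm. 1, p. 331: "Every
  initial data set has a development"; Sbierski, arXiv:1309.7591v3, Thm. 2.6; Ringström 2009,
  Thm. 14.2; Choquet-Bruhat 2009, Ch. XII, Thm. 12.1), a corollary of the former as a statement:
  `∀ [T2Space X] [SecondCountableTopology X] (D : InitialDataSet (𝓡 3) X) [D.metric.HasLeviCivita],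
     D.IsVacuumConstraintSolution → Nonempty (VacuumCauchyDevelopment D)`.

They are recorded, not declared, here (as in `CauchyProblemExistenceDefect` and
`MinkowskiCauchyDevelopment`): the first is an unproved named fact, which under D-0026 neither a
fact-proving nor a verdict clean-up seat may add (gate rule `lint.fact-fanout`; a lean-clean
version of this file declaring it, with local existence as its proved corollary, is held by the
clean-up seat for an operator landing), and their proofs — reduced Einstein equations in
harmonic gauge as a quasilinear hyperbolic system with constraint propagation and patching
(Ringström 2009, Ch. 9 and Ch. 14), local geometric uniqueness (Choquet-Bruhat–Geroch 1969,
Thm. 2), and the gluing of all globally hyperbolic developments along maximal common developments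
with the Hausdorff argument (Choquet-Bruhat–Geroch 1969, pp. 332–335; Sbierski 2016, §3) — have no
carrier in Mathlib or `Literature` (no Sobolev spaces on manifolds, no existence theory for
quasilinear wave equations, no quotient-manifold gluing). The uniqueness clause over the repaired
structure is reduced to rigidity in `CauchyProblemCauchy`
(`VacuumCauchyDevelopment.isIsometricTo_of_isMaximal`); `mghd_unique` itself is untouched.

## References

* Y. Choquet-Bruhat, R. Geroch, *Global aspects of the Cauchy problem in general relativity*,
  Comm. Math. Phys. 14 (1969), 329–335.
* Y. Fourès-Bruhat, *Théorème d'existence pour certains systèmes d'équations aux dérivées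
  partielles non linéaires*, Acta Math. 88 (1952), 141–225.
* J. Sbierski, *On the existence of a maximal Cauchy development for the Einstein equations: a
  dezornification*, Ann. Henri Poincaré 17 (2016), 301–329 (= arXiv:1309.7591v3, whose numbering
  is used where a version is named: Def. 2.1–2.2, Thm. 2.6 local existence and uniqueness,
  Thm. 2.7 global uniqueness, Thm. 2.8 existence of the MGHD; older docstrings of this cluster
  cite the MGHD theorem as "Thm. 2.6").
* H. Ringström, *The Cauchy Problem in General Relativity*, EMS 2009, Ch. 14–16.
* R. Penrose, *Gravitational collapse and space-time singularities*, Phys. Rev. Lett. 14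
  (1965), 57–59.
* S. W. Hawking, G. F. R. Ellis, *The large scale structure of space-time*, CUP 1973, §8.2.
* B. O'Neill, *Semi-Riemannian Geometry*, Academic Press 1983, Ch. 14.
-/

noncomputable section

open Manifold Bundle Set Topology
open scoped ContDiff

universe u

namespace Literature.Geometry.Lorentzian


/-! ### gr.S12: the Choquet-Bruhat–Geroch theorem -/

section CauchyProblem

variable {X : Type} [TopologicalSpace X] [ChartedSpace E3 X] [IsManifold (𝓡 3) ∞ X] [ConnectedSpace X]

/-- **Deprecated (verdict clean-up 2026-08-15): false as stated, refuted by
`not_choquetBruhat_geroch_exists_mghd` (`CauchyProblemExistenceDefect`); not to be used as a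
hypothesis.** The M5 rendering of **gr.S12**, existence of the maximal globally hyperbolic vacuum
development (Choquet-Bruhat–Geroch, Comm. Math. Phys. 14 (1969), Thm. 3, p. 332: "Let S be an
initial data set. Then there exists a development M of S which is an extension of every other
development of S"; Sbierski, Ann. Henri Poincaré 17 (2016) = arXiv:1309.7591v3, Thm. 2.8;
Ringström 2009, Thm. 16.6): every smooth vacuum initial data set `D = (h, k)` on a connected
`3`-manifold `X` (Hausdorff and second countable, bound inside) solving the vacuum constraint
equations has a vacuum development `𝒟` into which every vacuum development of `D` embeds
isometrically, compatibly with the embeddings of `X`. **What is wrong:** the conclusion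
`∃ 𝒟 : VacuumDevelopment D, 𝒟.IsMaximal` ranges over the prelude structure `VacuumDevelopment D`
(`Development.lean`), which is uninhabited for every data set (`VacuumDevelopment.isEmpty`,
`Development.elim`, `DevelopmentProofs`): its Cauchy-surface field is the mis-formalised
`LorentzianMetric.IsCauchySurface` (`Causality`), which counts every timelike curve with unbounded
parameter set as inextendible and is therefore uninhabited on nonempty manifolds
(`LorentzianMetric.IsCauchySurface.isEmpty`, `CausalityProofs`). Since the hypotheses are met by
the trivial data `(ℝ³, δ, 0)` on the Minkowski slice (`trivialData_isVacuumConstraintSolution_holds`,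
`ModelDataProofs`), the `def` is **refuted in the tree** — `not_choquetBruhat_geroch_exists_mghd`,
`choquetBruhat_geroch_exists_mghd_iff_false`, and `choquetBruhat_geroch_exists_mghd_iff` (it says
"`X` carries no vacuum data"), all in `CauchyProblemExistenceDefect` — and is kept, statement
byte-for-byte, solely as their subject. **The corrected statement** is this one verbatim with
`VacuumDevelopment ↦ VacuumCauchyDevelopment` (`CauchyDevelopment.lean`), recorded in the module
docstring (§ Verdict clean-up) under the name proposed for it,
`choquetBruhat_geroch_exists_mghd_cauchy`; the printed theorem is true. A mis-rendering of Choquet-Bruhat–Geroch 1969, Thm. 3.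
[cite: ChoquetBruhatGeroch1969CMP, Thm. 3 (p. 332)] -/
@[deprecated "`choquetBruhat_geroch_exists_mghd` is false as stated (refuted: \
  `not_choquetBruhat_geroch_exists_mghd`, `CauchyProblemExistenceDefect`); the corrected statement, \
  over `VacuumCauchyDevelopment`, is recorded in its docstring" (since := "2026-08-15")]
def choquetBruhat_geroch_exists_mghd : Prop :=
  ∀ [T2Space X] [SecondCountableTopology X] (D : InitialDataSet (𝓡 3) X) [D.metric.HasLeviCivita],
    D.IsVacuumConstraintSolution → ∃ 𝒟 : VacuumDevelopment D, 𝒟.IsMaximal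

/-- **gr.S12** (Choquet-Bruhat–Geroch, uniqueness clause; Choquet-Bruhat–Geroch, Comm. Math.
Phys. 14 (1969), Theorem p. 331; Sbierski, Ann. Henri Poincaré 17 (2016), Thm. 2.6 and §3;
Ringström 2009, Thm. 16.6). **Uniqueness of the MGHD.** Any two maximal globally hyperbolic
vacuum developments of the same initial data set are isometric as developments: there is a
time-orientation preserving isometric diffeomorphism `ψ : M₁ ≃ M₂` with `ψ ∘ ι₁ = ι₂`
("unique up to isometry fixing `Σ`"). No constraint hypothesis is needed: if `D` has a
development at all, the constraints hold. [cite: Ringstrom2009, Thm. 16.6] -/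
def mghd_unique : Prop :=
  ∀ {D : InitialDataSet (𝓡 3) X} (𝒟₁ 𝒟₂ : VacuumDevelopment D), 𝒟₁.IsMaximal → 𝒟₂.IsMaximal →
    𝒟₁.toDevelopment.IsIsometricTo 𝒟₂.toDevelopment

/-- **Deprecated (verdict clean-up 2026-08-15): false as stated, refuted by
`not_choquetBruhat_local_existence` (`CauchyProblemExistenceDefect`); not to be used as a
hypothesis.** The M5 rendering of **gr.S12**, local existence for the vacuum Einstein equations
(Fourès-Bruhat, Acta Math. 88 (1952), 141–225; Choquet-Bruhat–Geroch 1969, Thm. 1, p. 331: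
"Every initial data set has a development"; Choquet-Bruhat, *General Relativity and the Einstein
Equations* (OUP 2009), Ch. VI, Thm. 8.3 and Ch. XII, Thm. 12.1; Ringström 2009, Def. 14.1 and
Thm. 14.2, there stated for the Einstein–non-linear scalar field system (13.3)–(13.4), vacuum
being its case `V = 0`, `φ₀ = φ₁ = 0`, here `n = 3`; Sbierski, arXiv:1309.7591v3, Thm. 2.6): every
smooth vacuum initial data set solving the vacuum constraint equations admits a globally
hyperbolic vacuum development. **What is wrong:** the conclusion `Nonempty (VacuumDevelopment D)`
ranges over the uninhabited structure `VacuumDevelopment D` (`VacuumDevelopment.isEmpty`,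
`DevelopmentProofs`; see `choquetBruhat_geroch_exists_mghd`), so the `def` is equivalent to "`X`
carries no smooth solution of the vacuum constraints" (`choquetBruhat_local_existence_iff`) and
fails on the Minkowski slice (`not_choquetBruhat_local_existence`,
`choquetBruhat_local_existence_iff_false`, all in `CauchyProblemExistenceDefect`), while the
corrected conclusion is inhabited there (`nonempty_vacuumCauchyDevelopment_trivialData`,
`MinkowskiCauchyDevelopment`). Kept, statement byte-for-byte, solely as the subject of those
refutation theorems. **The corrected statement** is this one verbatim with
`VacuumDevelopment ↦ VacuumCauchyDevelopment`, recorded in the module docstring (§ Verdict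
clean-up); as a statement it is a corollary of the corrected MGHD theorem. The printed theorem is
true. A mis-rendering of Choquet-Bruhat–Geroch 1969, Thm. 1. [cite: ChoquetBruhatGeroch1969CMP, Thm. 1 (p. 331)] -/
@[deprecated "`choquetBruhat_local_existence` is false as stated (refuted: \
  `not_choquetBruhat_local_existence`, `CauchyProblemExistenceDefect`); the corrected statement, \
  over `VacuumCauchyDevelopment`, is recorded in its docstring" (since := "2026-08-15")]
def choquetBruhat_local_existence : Prop :=
  ∀ [T2Space X] [SecondCountableTopology X] (D : InitialDataSet (𝓡 3) X) [D.metric.HasLeviCivita],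
    D.IsVacuumConstraintSolution → Nonempty (VacuumDevelopment D)

/-- The existence of an MGHD implies local existence (sanity link between the two forms of
gr.S12; Choquet-Bruhat–Geroch, Comm. Math. Phys. 14 (1969), p. 330). [folklore] -/
theorem nonempty_vacuumDevelopment_of_exists_isMaximal {D : InitialDataSet (𝓡 3) X}
    (h : ∃ 𝒟 : VacuumDevelopment D, 𝒟.IsMaximal) : Nonempty (VacuumDevelopment D) :=
  let ⟨𝒟, _⟩ := h; ⟨𝒟⟩

-- `linter.deprecated` is off for the next declaration only: it is the (deprecated) link between
-- the two deprecated facts and must name them.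
set_option linter.deprecated false in
/-- **Deprecated with the two facts it links (verdict clean-up 2026-08-15).** The MGHD form of
gr.S12 implies the local existence form: as named facts over the (uninhabited) vendored structure
`VacuumDevelopment`, `choquetBruhat_local_existence` carries no content beyond
`choquetBruhat_geroch_exists_mghd`; both are false and in fact *equivalent*, each saying "no
vacuum data on `X`" (`choquetBruhat_geroch_exists_mghd_iff_local_existence`,
`CauchyProblemExistenceDefect`). Over the repaired structure the same one-line argument gives the
link between the corrected statements (`nonempty_vacuumCauchyDevelopment_of_exists_isMaximal`,
`MinkowskiCauchyDevelopment`); in the printed proofs the implication runs the other way (local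
existence, Ringström 2009, Thm. 14.2, is the input to the construction of the MGHD, Thm. 16.6).
[folklore] -/
@[deprecated "links the two deprecated (false) facts; over the repaired structure use \
  `nonempty_vacuumCauchyDevelopment_of_exists_isMaximal`" (since := "2026-08-15")]
theorem choquetBruhat_local_existence_of_exists_mghd
    (h : choquetBruhat_geroch_exists_mghd (X := X)) : choquetBruhat_local_existence (X := X) := by
  intro _ _ D _ hD
  exact nonempty_vacuumDevelopment_of_exists_isMaximal (h D hD)

end CauchyProblem

/-! ### gr.S11: the Penrose singularity theorem -/

/-- **gr.S11** (Penrose singularity theorem; Penrose, Phys. Rev. Lett. 14 (1965), 57–59;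
Hawking–Ellis 1973, §8.2, Thm. 1; O'Neill 1983, Thm. 14.61). Let `(M, g, τ)` be a
four-dimensional spacetime which is globally hyperbolic with a non-compact Cauchy hypersurface
`S`, and which satisfies the null convergence condition `Ric(v, v) ≥ 0` for all null `v`
(implied by the Einstein equations with the null/weak energy condition). If `M` contains a
closed trapped surface — a compact spacelike `2`-surface `f : T → M` both of whose future null
expansions are everywhere negative — then `(M, g, τ)` is future null geodesically incomplete:
some future-directed inextendible null geodesic has bounded-above affine parameter. [cite: HawkingEllis1973, §8.2  Thm. 1] -/
def penrose_singularity_theorem : Prop :=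
  ∀ (𝓢 : Spacetime.{u} 4) [𝓢.metric.HasLeviCivita],
    𝓢.metric.IsGloballyHyperbolic 𝓢.timeOrientation →
    ∀ (S : Set 𝓢.carrier), 𝓢.metric.IsCauchySurface 𝓢.timeOrientation S → ¬ IsCompact S →
    𝓢.metric.SatisfiesNullConvergence →
    ∀ {T : Type} [TopologicalSpace T] [ChartedSpace (EuclideanSpace ℝ (Fin 2)) T]
      [IsManifold (𝓡 2) ∞ T] [CompactSpace T] [T2Space T] [Nonempty T] (f : T → 𝓢.carrier),
      𝓢.metric.IsTrappedSurface (𝓡 2) 𝓢.timeOrientation f →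
    𝓢.metric.IsFutureNullGeodesicallyIncomplete 𝓢.timeOrientation

/-! ### Sanity statements: Minkowski spacetime -/

/-- **Minkowski spacetime is geodesically complete**: the Levi-Civita connection of `η` is the
flat connection on `ℝ⁴`, whose geodesics are the affinely parametrised straight lines, defined
on all of `ℝ`. O'Neill 1983, Ch. 3, Ex. 3.24 and Ch. 5, Ex. 5.1; Hawking–Ellis 1973, §5.1.
(Untagged sanity statement for the notions entering gr.S11 and gr.S12.) [cite: ONeill1983, Ch. 3  Ex. 3.24 and Ch. 5  Ex. 5.1] -/
def minkowski_isGeodesicallyComplete : Prop :=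
  ∀ [Minkowski.spacetime.metric.HasLeviCivita],
    IsGeodesicallyComplete Minkowski.spacetime.metric.toPseudoRiemannianMetric.leviCivita

/-- **Minkowski spacetime is globally hyperbolic** (in the Bernal–Sánchez form: no closed causal
curves and compact causal diamonds; equivalently `{t = 0}` is a Cauchy hypersurface).
Hawking–Ellis 1973, §5.1 and Prop. 6.6.8; O'Neill 1983, Ch. 14, Ex. 14.9; Bernal–Sánchez,
Class. Quantum Grav. 24 (2007), Thm. 3.2. (Untagged sanity statement.) [cite: HawkingEllis1973, §5.1 and Prop. 6.6.8] -/
def minkowski_isGloballyHyperbolic : Prop :=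
  Minkowski.spacetime.metric.IsGloballyHyperbolic Minkowski.spacetime.timeOrientation

/-- The slice `{t = 0}` of Minkowski spacetime is a non-compact Cauchy hypersurface, so
Minkowski spacetime satisfies the causal hypotheses of the Penrose theorem (and, being
geodesically complete and vacuum, contains no closed trapped surface). Hawking–Ellis 1973,
§5.1; O'Neill 1983, Ch. 14, Ex. 14.9. (Untagged sanity statement; the Cauchy-surface half is
the `ModelData` named fact `Minkowski.isCauchySurface_range_sliceEmbed`, threaded as `h`
(D-0014); non-compactness is proved: the spatial projection of the slice is all of `E3`.) [cite: HawkingEllis1973, §5.1] -/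
theorem minkowski_not_isCompact_cauchySurface (h : Minkowski.isCauchySurface_range_sliceEmbed) :
    Minkowski.spacetime.metric.IsCauchySurface Minkowski.spacetime.timeOrientation
        (range Minkowski.sliceEmbed) ∧
      ¬ IsCompact (range Minkowski.sliceEmbed) := by
  refine ⟨h, fun hc ↦ ?_⟩
  have himg : E4.spatial '' range Minkowski.sliceEmbed = univ := by
    refine eq_univ_of_forall fun y ↦ ⟨Minkowski.sliceEmbed ⟨y, Minkowski.mem_slice y⟩, ⟨_, rfl⟩, ?_⟩
    simp [Minkowski.sliceEmbed_apply, E4.spatial_ofTimeSpace]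
  have := hc.image E4.spatial.continuous
  rw [himg] at this
  exact noncompact_univ E3 this

end Literature.Geometry.Lorentzian

end
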